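import Summits.MatrixMultiplication.MatrixMultiplication.Theses.FidelityWitnesses
import Summits.MatrixMultiplication.MatrixMultiplication.Theorems.SevenEighthsLaw.Negative.SharpConstants
import Literature.Computability.AlgebraicComplexity.BorderRankMatMulTwoApolarity
import Literature.Computability.AlgebraicComplexity.BorderApolarityGeneric

/-!
# Line `sharp-grassmann-apolarity` for crux `FidelityWitnesses.SevenEighthsLaw` (stmt-MatrixMultiplication-4959)

Skeleton (crux-plan, planner-cruxplan-stmt-MatrixMultiplication-4959-sharp-grassmann-apol-0, 2026-08-16) of
idea card `Cruxes/SevenEighthsLaw/Ideas/sharp-grassmann-apolarity.md` (crux-ideate r1, ideator 1; triage r1-1,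
r1-2, r1-3: **pass** ×3, sharpenings built in — see the line card `Lines/sharp-grassmann-apolarity.md`).

THE CRUX. `SevenEighthsLaw : ∀ S : P2 → P2 → P2 → ℂ, tensorRank S ≤ 6 → ‖∑ S·⟨2,2,2⟩‖² ≤ 7 · ∑ ‖S‖²`
(`M(2,6) = 7`: no rank-6 tensor captures more than `7/8` of `⟨2,2,2⟩`; `P2 = Fin 2 × Fin 2`; slots of a
tensor `t a b c`: `a = (κ,ν)` the OUTPUT/`C` slot, `b = (κ,μ) ∈ A`, `c = (μ,ν) ∈ B` — the tree's
`matMulTensor ℂ 2 2 2 a b c = [a.1 = b.1][b.2 = c.1][a.2 = c.2]`, and `annSub`, `MatMulTwo.mul210/mul120` act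
on the `(b, c)` slots exactly as in the tree's proof of `7 ≤ R̲(⟨2,2,2⟩)`).

THE LINE (exact output elimination + weak border apolarity ⇒ a height bound on a compact variety of
10-planes). Write `W := span{T_a : a ∈ P2} ⊂ ℂ^{P2 × P2}` for the 4-plane spanned by the output slices
`T_a = ⟨2,2,2⟩(a,·,·)` (real, pairwise orthogonal, `‖T_a‖² = 2`; `W = U ⊗ Id_V ⊗ W'`, "identity in the
middle"), and for an orthonormal 10-frame `Y` of bilinear forms on `A × B` its F-HEIGHT
`h(Y) := tr(P_{span Y} Π_W) = ½ Σ_r Σ_{κν} |Σ_μ Y_r((κ,μ),(μ,ν))|² ∈ [0, 4]` (`heightF`).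
* `stub_passingFrame_of_borderRank_le_six` (G1, the K-input = weak border apolarity at `(n,r) = (2,6)` in frame
  form): every `S` of border rank `≤ 6` has an orthonormal 10-frame `Y ⊂ annSub S` whose `(210)` and `(120)`
  multiplication maps have rank `≤ 34 = 40 − 6` (`PassesTests`). Tree machinery
  (`TensorApolarity.exists_subspace_of_algBorderRank_le` = first half of
  `MatMulTwo.seven_le_algBorderRank_matMulTensor_two`) + Gram–Schmidt; it is the sibling line's
  `QuantitativeApolarity.stub_annFrame_of_rank_le_six` with `tensorRank` weakened to `algBorderRank`.
* `stub_outputElimination` (G2, exact elimination of the output factor): if the orthonormal frame `Y`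
  annihilates the slices of `S`, then `|⟨S,⟨2,2,2⟩⟩|² ≤ 2·(4 − h(Y))·‖S‖²` — Bessel for the orthonormal
  system `conj Y_r` plus Cauchy–Schwarz slice by slice (`Σ_a ‖T_a‖² = 8`, `Σ_a Σ_r |⟨conj Y_r, T_a⟩|² = 2h(Y)`).
* `stub_sharpGrassmannApolarity` (G3 = the Transfer `C⁺`, THE LOAD-BEARING stub): every orthonormal 10-frame
  passing both tests has `h(Y) ≥ ½` — `min h = ½` on the compact, equation-defined variety
  `𝒱 ⊂ Gr(10, A*⊗B*)` of passing planes (equivalently, E-form: every 6-plane `E = Y^⊥` with both first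
  prolongations of dimension `≥ 6` captures `Σ_a ‖P_E T_a‖² ≤ 7`). Sharp: `½` is attained (honest
  Winograd/Strassen-six frame, `exists_passingFrame_height_le_half` below) and cannot be raised
  (`heightHalf_sharp` below, from the landed `sevenEighthsLaw_tight`).
* `SevenEighthsLaw_of` — the kernel-checked composition (`sevenEighths_of_stubs`, pure arithmetic):
  `R(S) ≤ 6 ⇒ R̲(S) ≤ 6` (`algBorderRank_le_tensorRank`) ⇒ a passing frame `Y ⊂ annSub S` (G1) ⇒
  `h(Y) ≥ ½` (G3) ⇒ `|⟨S,T⟩|² ≤ 2(4 − ½)‖S‖² = 7‖S‖²` (G2).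

DISPROOF USED (`Cruxes/SevenEighthsLaw/Disproof.lean` v4 and the LANDED
`Theorems/SevenEighthsLaw/Negative/SharpConstants.lean`, p75228, imported here):
(H = rank `≤ 6`, `sevenEighthsLaw_false_without_rank_bound` / `_false_with_rank_seven`) — the line uses H at
G1 and only there: six (border) points impose `≤ 6` conditions, `dim ≥ 16 − 6 = 10`; with seven points only
9-frames survive and Strassen's seven products give a passing 9-frame of height `0`, so no 9-frame analogue of
G3 is claimed. (Tightness, `sevenEighthsLaw_tight` / `_not_strengthened` / `_attained`) — G3 states the constant
`½ = 4 − 7/2` exactly; `heightHalf_sharp` derives from `sevenEighthsLaw_tight` + G1 + G2 that `½ + η` is false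
for every `η > 0`, and `exists_passingFrame_height_le_half` derives from `sevenEighthsLaw_attained` + G1 + G2 a
passing frame of height `≤ ½` (the frame of `⟨2,2,2⟩ − a₂₂⊗b₂₂⊗c₂₂`; exact check in this seat's
`num/sanity.py`: `h = ½`, test ranks `(34, 34)`). (Kill switches `sevenEighthsLaw_not_of_int` /
`_not_of_dist_lt_one`) — a refutation of G3 is NOT a refutation of the crux (G3 is a relaxation: passing planes
need not come from points); the line card names the fallback `C⁺⁺` (honest component). Disproof § (c)–(e)
(second variation negative semidefinite at `T − E`, pencil dead, 1030 descents → 7) and the triage censuses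
(r1-3 F4: 92,758 torus-fixed planes, 85,342 passing, `min h = ½`, none below; 387,478 low-height candidates:
0 pass) are the evidence for G3. Negatives index (`ledger negatives --problem MatrixMultiplication`: STPP
designs ×2, level-graded Cohn–Umans, design flattening) — unrelated statements; no stub is an instance.
-/

noncomputable section

namespace Summit.MatrixMultiplication.MatrixMultiplication.Cruxes.SevenEighthsLaw.SharpGrassmannApolarity

open scoped BigOperators ComplexConjugate
open Literature.Computability.AlgebraicComplexity
open Summit.MatrixMultiplication.MatrixMultiplication.Theses.FidelityWitnesses
open Summit.MatrixMultiplication.MatrixMultiplication.Theorems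

set_option linter.unusedVariables false
set_option linter.dupNamespace false

/-! ## Vocabulary -/

/-- A slot of `⟨2,2,2⟩`: index pairs (the tree's `MatMulTwo.P2`). -/
abbrev P2 : Type := Fin 2 × Fin 2

/-- The `(210)` multiplication map of a `10`-frame `Y` of bilinear forms on `A × B`:
`v ↦ ∑_{r, a₀} v(r, a₀) · (Y_r · e_{a₀}) ∈ S²A* ⊗ B*` in the tree's ordered coordinates
(`MatMulTwo.mul210`); its range is the product space `(span Y) · A*` of the `(210)` test
(same definition as the sibling line `Cruxes/FidelityGapTwoSix/Lines/quantitative-apolarity.lean`). -/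
def M210Lin (Y : Fin 10 → (P2 × P2 → ℂ)) : (Fin 10 × P2 → ℂ) →ₗ[ℂ] (P2 × P2 × P2 → ℂ) :=
  ∑ x : Fin 10 × P2, (LinearMap.proj x : (Fin 10 × P2 → ℂ) →ₗ[ℂ] ℂ).smulRight
    (MatMulTwo.mul210 ℂ x.2 (Y x.1))

/-- The `(120)` multiplication map of a `10`-frame: `v ↦ ∑_{r, b₀} v(r, b₀) · (Y_r · e_{b₀}) ∈ A* ⊗ S²B*`
(`MatMulTwo.mul120`); its range is `(span Y) · B*`. -/
def M120Lin (Y : Fin 10 → (P2 × P2 → ℂ)) : (Fin 10 × P2 → ℂ) →ₗ[ℂ] (P2 × P2 × P2 → ℂ) :=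
  ∑ x : Fin 10 × P2, (LinearMap.proj x : (Fin 10 × P2 → ℂ) →ₗ[ℂ] ℂ).smulRight
    (MatMulTwo.mul120 ℂ x.2 (Y x.1))

/-- Unfolding lemma. -/
theorem M210Lin_apply (Y : Fin 10 → (P2 × P2 → ℂ)) (v : Fin 10 × P2 → ℂ) :
    M210Lin Y v = ∑ x : Fin 10 × P2, v x • MatMulTwo.mul210 ℂ x.2 (Y x.1) := by
  simp [M210Lin, LinearMap.sum_apply]

/-- Unfolding lemma. -/
theorem M120Lin_apply (Y : Fin 10 → (P2 × P2 → ℂ)) (v : Fin 10 × P2 → ℂ) :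
    M120Lin Y v = ∑ x : Fin 10 × P2, v x • MatMulTwo.mul120 ℂ x.2 (Y x.1) := by
  simp [M120Lin, LinearMap.sum_apply]

/-- `Y` is an ORTHONORMAL `10`-FRAME of bilinear forms on `A × B` for the standard Hermitian product of
`ℂ^{P2 × P2}` (unit norms stated over `ℝ`, orthogonality over `ℂ`); it spans a point of `Gr(10, A* ⊗ B*)`. -/
def IsOrthonormalFrame (Y : Fin 10 → (P2 × P2 → ℂ)) : Prop :=
  (∀ r, ∑ p, ‖Y r p‖ ^ 2 = 1) ∧ (∀ r r', r ≠ r' → ∑ p, conj (Y r p) * Y r' p = 0)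

/-- `Y` PASSES THE `(210)` AND `(120)` TESTS of weak border apolarity at `r = 6`:
`dim (span Y)·A* ≤ 34` and `dim (span Y)·B* ≤ 34` (`34 = dim S²A*⊗B* − 6`), as ranks of the two
multiplication maps. These are explicit rank conditions on two `64 × 40` matrices linear in `Y`, invariant
under `GL(A*) × GL(B*)`; they cut out the compact variety `𝒱 ⊂ Gr(10,16)` of the line. Dually
(`E := Y^⊥ ⊂ A ⊗ B`, a `6`-plane of `4 × 4` matrices): `dim {Φ ∈ S²A ⊗ B : Φ(α,·,·) ∈ E ∀ α} ≥ 6` and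
`dim {Ψ ∈ A ⊗ S²B : Ψ(·,·,β) ∈ E ∀ β} ≥ 6` (both first prolongations of `E` have dimension `≥ 6`). -/
def PassesTests (Y : Fin 10 → (P2 × P2 → ℂ)) : Prop :=
  Module.finrank ℂ (LinearMap.range (M210Lin Y)) ≤ 34 ∧
  Module.finrank ℂ (LinearMap.range (M120Lin Y)) ≤ 34

/-- The F-HEIGHT of a `10`-frame against the slice `4`-plane `W = span{T_a}` of `⟨2,2,2⟩`:
`h(Y) = ½ Σ_r Σ_{κ,ν} |Σ_μ Y_r((κ,μ),(μ,ν))|²`. For an orthonormal frame this is `tr(P_{span Y} Π_W)`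
(`Σ_μ Y_r((κ,μ),(μ,ν)) = Σ_{b,c} Y_r(b,c)·T((κ,ν),b,c) = ⟨conj Y_r, T_{(κ,ν)}⟩` and `Π_W = ½ Σ_a T_a T_a^*`),
a real number in `[0, 4]`; `h = 0` iff `span Y ⊆ annSub ⟨2,2,2⟩ = W^⊥`. -/
def heightF (Y : Fin 10 → (P2 × P2 → ℂ)) : ℝ :=
  (∑ r, ∑ κ : Fin 2, ∑ ν : Fin 2, ‖∑ μ : Fin 2, Y r ((κ, μ), (μ, ν))‖ ^ 2) / 2

/-- The TRANSFER `C⁺` of the idea card (SHARP GRASSMANN APOLARITY): the F-height of every orthonormal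
`10`-frame passing both tests is `≥ ½`, i.e. `min {h(Y) : span Y ∈ 𝒱} = ½`. It is `stub_sharpGrassmannApolarity`
verbatim (`sharpGrassmannApolarity_iff`); it implies the crux through G1 and G2 (`SevenEighthsLaw_of`). -/
def SharpGrassmannApolarity : Prop :=
  ∀ Y : Fin 10 → (P2 × P2 → ℂ), IsOrthonormalFrame Y → PassesTests Y → (1 / 2 : ℝ) ≤ heightF Y

/-! ## The stubs -/

/-- **Stub G1 — weak border apolarity for border rank `≤ 6`, frame form (the K-input).** Every tensor `S` in
the `2 × 2` format with `R̲(S) ≤ 6` (the tree's `algBorderRank` over `ℂ[ε]`) has an orthonormal `10`-frame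
`Y ⊂ annSub S` passing both rank tests.
Why plausibly true (essentially in the tree): `TensorApolarity.exists_subspace_of_algBorderRank_le S hr e`
(`e : Fin 6 ↪ P2 × P2`; it PERTURBS an arbitrary, possibly degenerate, approximate decomposition into general
position by `IsApproxDecomposition.perturb` + `det_pt_perturb_ne_zero`) gives `F ≤ slicePerp S = annSub S` with
`finrank F ≥ 16 − 6 = 10`, `finrank (prodA F ⊔ altA) ≤ 64 − 6`, `finrank (prodB F ⊔ altB) ≤ 64 − 6`; with
`prodA_inf_altA_eq_bot` (char `0`) and `finrank altA = 24` this reads `finrank (F·A*) ≤ 34`, and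
`mulA f (Pi.single a₀ 1) = MatMulTwo.mul210Fun a₀ f` entrywise, so `F·A* = ⨆ a₀, F.map (mul210 ℂ a₀)`;
equivalently run the first half of `MatMulTwo.seven_le_algBorderRank_matMulTensor_two` verbatim for a general
`S` (`isApproxDecomposition_pert`, `finrank_I21_pert_add_le`, `finrank_I12_pert_add_le`, `limSub_I11_le_annSub`,
`map_mul210_limSub_le`, `map_mul120_limSub_le`, `finrank_symA_le`, `finrank_symB_le`), stopped before the
torus degeneration. Then choose a `10`-dimensional `F' ≤ F` (monotonicity keeps both bounds), take an
orthonormal basis of `F'` for the standard Hermitian product (Gram–Schmidt in `EuclideanSpace ℂ (P2 × P2)`,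
transported by `WithLp.equiv`; the ranges depend only on the span) and note
`LinearMap.range (M210Lin Y) = ⨆ a₀, (span (range Y)).map (mul210 ℂ a₀)` (`M210Lin_apply`). True also for
`S = 0` (`annSub 0 = ⊤`; forms vanishing at six generic points of `A × B` do it).
It is `QuantitativeApolarity.stub_annFrame_of_rank_le_six` of the sibling line
(`Cruxes/FidelityGapTwoSix/Lines/quantitative-apolarity.lean`, home item stmt-14041) with the hypothesis
weakened from `tensorRank S ≤ 6` to `algBorderRank S ≤ 6`: one proof serves both (`algBorderRank_le_tensorRank`).
Exact check (this seat, `num/sanity.py`): honest rank-6 frames pass with ranks `(34, 34)`; `dim annSub ⟨2,2,2⟩ = 12`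
and all `66` torus-fixed `10`-frames of it fail (min-max rank `35`, the tree certificate); random `10`-frames
give `(40, 40)`. Size M (all ingredients in tree/Mathlib; the work is the coordinate bookkeeping
span/frame/range). This is where the hypothesis `R(S) ≤ 6` of the crux is consumed, and only here. -/
theorem stub_passingFrame_of_borderRank_le_six :
    ∀ S : P2 → P2 → P2 → ℂ, algBorderRank S ≤ 6 →
      ∃ Y : Fin 10 → (P2 × P2 → ℂ), IsOrthonormalFrame Y ∧ PassesTests Y ∧ ∀ r, Y r ∈ annSub S := by
  sorry

/-- **Stub G2 — exact elimination of the output factor (projection bound).** If an orthonormal `10`-frame `Y`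
annihilates every output slice of `S` (`Y_r ∈ annSub S`, i.e. `Σ_{b,c} Y_r(b,c) S(a,b,c) = 0` for all `a`), then
`|⟨S, ⟨2,2,2⟩⟩|² ≤ 2·(4 − h(Y))·‖S‖²`.
Why true (four lines on paper): put `z_r := conj Y_r` (orthonormal in `ℂ^{P2×P2}`), `x_a := S(a,·,·)`,
`t_a := T(a,·,·)` (real `0/1`, `‖t_a‖² = 2`). Annihilation says `⟨z_r, x_a⟩ = 0`; the overlap is
`Σ_a Σ_p x_a(p) t_a(p) = Σ_a ⟨t_a, x_a⟩` (Hermitian product, `t_a` real). With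
`t'_a := t_a − Σ_r ⟨z_r, t_a⟩ z_r` one has `⟨t_a, x_a⟩ = ⟨t'_a, x_a⟩`, `|⟨t'_a, x_a⟩| ≤ ‖t'_a‖ ‖x_a‖` and
`‖t'_a‖² = 2 − Σ_r |⟨z_r, t_a⟩|²` (Pythagoras/Bessel for the orthonormal `z_r`), where
`⟨z_r, t_a⟩ = Σ_{b,c} Y_r(b,c) T(a,b,c) = Σ_μ Y_r((a.1,μ),(μ,a.2))` (the only `b, c` with `T(a,b,c) = 1` are
`b = (a.1,μ)`, `c = (μ,a.2)`); hence `Σ_a ‖t'_a‖² = 8 − 2·heightF Y` and, by Cauchy–Schwarz over `a`,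
`|Σ_a ⟨t_a,x_a⟩|² ≤ (Σ_a ‖x_a‖²)(Σ_a ‖t'_a‖²) = ‖S‖² · 2(4 − h(Y))`. Equality analysis: equality needs
`x_a ∥ t'_a` for all `a` with a common ratio — the LEAST-SQUARES optimum `S = (P_{Y^⊥} ⊗ 1) T` of the twin
E-picture cards (`M(2,6) = 2·sup_E tr(P_E Π_W)`). Exact checks (`num/sanity.py`): `h = ½` at the frame of
`⟨2,2,2⟩ − a₂₂⊗b₂₂⊗c₂₂` (overlap `7`, `‖S‖² = 7`: the bound `2(4 − ½)·7 = 49` is attained), `h = 0` on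
`annSub ⟨2,2,2⟩`. Size S–M (finite sums over `P2 × P2`; `Finset.inner_mul_le_norm_mul_norm` /
`norm_inner_le_norm` on `EuclideanSpace ℂ (P2 × P2)` or the real Cauchy–Schwarz `Finset.sum_mul_sq_le_sq_mul_sq`
after `norm_sum_le`; Bessel as the explicit algebra `‖t − Σ⟨z_r,t⟩z_r‖² = ‖t‖² − Σ|⟨z_r,t⟩|²` from
`IsOrthonormalFrame`, or `Orthonormal.sum_inner_products_le`; the slice identity by
`Fintype.sum_prod_type` + `Finset.sum_ite_eq`). No rank hypothesis, no tests: pure Hermitian geometry. -/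
theorem stub_outputElimination :
    ∀ (S : P2 → P2 → P2 → ℂ) (Y : Fin 10 → (P2 × P2 → ℂ)), IsOrthonormalFrame Y →
      (∀ r, Y r ∈ annSub S) →
      ‖∑ a, ∑ b, ∑ c, S a b c * matMulTensor ℂ 2 2 2 a b c‖ ^ 2
        ≤ 2 * (4 - heightF Y) * ∑ a, ∑ b, ∑ c, ‖S a b c‖ ^ 2 := by
  sorry

/-- **Stub G3 — SHARP GRASSMANN APOLARITY (the Transfer `C⁺`; THE LOAD-BEARING stub, hardest of the line).**
Every orthonormal `10`-frame of `A* ⊗ B*` passing the `(210)` and `(120)` tests has F-height `≥ ½`: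
`min { h(Y) : span Y ∈ 𝒱 } = ½` on the compact real-algebraic set of passing frames (a `U(10)`-bundle over the
projective variety `𝒱 ⊂ Gr(10,16)` cut out by the `35 × 35` minors of two `64 × 40` matrices linear in `Y`).
E-FORM (equivalent, `E := Y^⊥`, `6`-planes of `4 × 4` matrices): if both first prolongations
`{Φ ∈ S²A⊗B : Φ(α) ∈ E ∀α}`, `{Ψ ∈ A⊗S²B : Ψ(β) ∈ E ∀β}` have dimension `≥ 6`, then
`c(E) := Σ_a ‖P_E T_a‖² = 2 tr(P_E Π_W) ≤ 7`.
WHY PLAUSIBLY TRUE. (a) Qualitative shadow PROVED: `h = 0` (i.e. `span Y ⊆ annSub ⟨2,2,2⟩`) is impossible for a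
passing frame — this is exactly the tree theorem `MatMulTwo.seven_le_algBorderRank_matMulTensor_two` (torus
degeneration + the kernel-checked certificate `MatMulTwo.rank_test_ge` on the `66` torus-fixed candidates). (b) On
the HONEST component `𝒱_hon = closure{I_Z(1,1) : Z ∈ (ℙ³×ℙ³)⁶ in (1,1)-general position}` the statement is the
crux itself in compact clothes (`c(E) ≤ 7` for product-spanned `E`, the twin cards' `ProductSpanCapture` /
`BellWeightBound`), supported by every numeric run on the item (160/160 exact-elimination ascents → `c = 7.000000`,
680 six-dimensional border-stratum runs `≤ 7`, 1030 ALS descents → ratio `7`, kit j008098; Disproof § (e)) and by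
the second-order analysis at `T − E` (Disproof § (c): criticality exact, transversal form negative semidefinite,
inertia `(0,53,19)`; triage r1-3 F2: Hessian inertia `(0,38,106)`). (c) On the SPURIOUS part of `𝒱` (passing
planes not from points — it is large: `92 %` of torus-fixed planes pass; e.g. `Y ⊇ α ⊗ B*` passes for EVERY
complementary `6`-plane, quotient count `16 + 18 ≤ 34` / `10 + 24 ≤ 34`) the height is bounded away from `½`
wherever it has been computed: `Y ⊇ α⊗B*` or `Y ⊇ A*⊗β` forces `h ≥ 1` (`h` is monotone in `span Y` and
`h(α̂ ⊗ B*) = ‖α̂‖² = 1`; exact checks `h = 2.84, 2.46` in `num/sanity.py`), `Y ⊇ A′⊗B*` forces `h ≥ 2`; the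
torus-fixed census of triage r1-3 (F4: all `10`-planes `Y = ⊕_{κν}(Y ∩ D_{κν}) ⊕` coordinate lines, `92,758`
planes, `85,342` passing) has `min h = ½` EXACTLY, attained only at Białynicki-Birula limits of the honest flat
family, and a targeted census of `387,478` low-height candidates (`Σ h_block < ½`, negative real/complex ratios)
finds `0` passing planes (near-miss: all-`(1:−2)` blocks pass `(210)` at rank `34` but fail `(120)` at `36` — the
`(120)` test is load-bearing; `(210)` alone is passed at `h = 0.4`).
EQUALITY LOCUS (triage r1-1 F1 / r1-2 F3 / r1-3 F3 — a certificate must be tight on all of it): `h = ½` on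
`{Y passing : Y^⊥ ⊇ Σ(⟨2,2,2⟩ − E_xyz)}` — this contains the `K_T`-orbit of the Winograd frame `Y₀`, the CLOSURE
of its non-compact `3`-parameter stabiliser-torus family `(τ·U*)^⊥` (pairwise `U(2)³`-inequivalent), border
planes such as `U(∞)^⊥ = (lim Bini product planes)^⊥`, and torus-fixed planes; conjecturally nothing else. So the
minimiser set is positive-dimensional modulo `U(2)³` and reaches torus-fixed points: GOOD for a
Borel/torus-fixed-style case analysis of the equality locus, BAD for a strict-slack Putinar certificate (finite
convergence fails exactly there) — an SOS proof must carry the equality ideal explicitly.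
INTENDED ATTACKS (prover's choice; the statement is fixed): (1) torus-fixed census made exact — finitely many
combinatorial types `(Y ∩ D_{κν} ∈ {0, line (α:β), D_{κν}})`, rank conditions polynomial in `≤ 4` projective
ratios, `h = Σ |α+β|²/(2(|α|²+|β|²)) (+1 per full block)`: resultants / Gröbner over `ℚ` (kit), replayed by
`norm_num`/`decide` — the mandatory first sub-case and the equality data; (2) structure of `𝒱`: components
through the prolongation conditions (`E_A^{(1)} = ker[A⊗E → Λ²A⊗B]`, `24 × 24` matrices linear in `E`), honest
component by the E-picture LMI/Schur form `Σ_a h_a G⁻¹ h_a* ≤ 7/2` (ideator 3) with the stratum identity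
`c(U) = 7 + ‖P_{U ⊖ Σ} e_AB‖²`-type rigidity near the equality locus, spurious components by containment lemmas of
the `α⊗B*` kind; (3) the card's stratification by `d := dim(Y^⊥ ∩ W) ∈ {0,1,2,3}` with Kronecker normal forms of
`Y^⊥ ∩ W ⊂ W ≅ M₂` under `GL₂ × GL₂` (optimum stratum `d = 3`, rank-one type ⟺ the 12-parameter single-slice
completion bound `R̲(⟨2,2,2⟩ + N⊗e_out) ≤ 6, N ∈ W^⊥ ⇒ ‖N‖² ≥ 2`); (4) symmetry-reduced SOS on `St(10,16)` modulo
the test ideal, vanishing on the equality locus.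
WHY IT MIGHT FAIL: `C⁺` is a RELAXATION of the crux — a spurious component of `𝒱` (passing planes that are not
limits of point ideals) dipping below `½` kills THIS stub while the crux survives; none is known (census above;
kit probes j008313 part 2 / j008703 of the ideator), and the fallback `C⁺⁺` (same statement on `𝒱_hon`, crux-
equivalent, still compact) is spelled out in the line card. Size XL. -/
theorem stub_sharpGrassmannApolarity :
    ∀ Y : Fin 10 → (P2 × P2 → ℂ), IsOrthonormalFrame Y → PassesTests Y → (1 / 2 : ℝ) ≤ heightF Y := by
  sorry

/-- `C⁺` is the statement of `stub_sharpGrassmannApolarity`, by `rfl`. -/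
theorem sharpGrassmannApolarity_iff :
    SharpGrassmannApolarity ↔
      ∀ Y : Fin 10 → (P2 × P2 → ℂ), IsOrthonormalFrame Y → PassesTests Y → (1 / 2 : ℝ) ≤ heightF Y :=
  Iff.rfl

/-! ## The composition (kernel-checked, no `sorry` of its own) -/

/-- **Pure-logic composition.** From (G1) passing annihilating frames for border rank `≤ 6`, (G2) the output
elimination bound and (G3) the height bound `h ≥ ½` on passing frames, the `7/8` law follows:
`R(S) ≤ 6 ⇒ R̲(S) ≤ 6 ⇒ ∃ Y ⇒ |⟨S,T⟩|² ≤ 2(4 − h(Y))‖S‖² ≤ 2(4 − ½)‖S‖² = 7‖S‖²`. Stated with the three stub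
statements as explicit hypotheses (conclusion = the crux's body), so that the implication itself is closed. -/
theorem sevenEighths_of_stubs
    (hG1 : ∀ S : P2 → P2 → P2 → ℂ, algBorderRank S ≤ 6 →
      ∃ Y : Fin 10 → (P2 × P2 → ℂ), IsOrthonormalFrame Y ∧ PassesTests Y ∧ ∀ r, Y r ∈ annSub S)
    (hG2 : ∀ (S : P2 → P2 → P2 → ℂ) (Y : Fin 10 → (P2 × P2 → ℂ)), IsOrthonormalFrame Y →
      (∀ r, Y r ∈ annSub S) →
      ‖∑ a, ∑ b, ∑ c, S a b c * matMulTensor ℂ 2 2 2 a b c‖ ^ 2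
        ≤ 2 * (4 - heightF Y) * ∑ a, ∑ b, ∑ c, ‖S a b c‖ ^ 2)
    (hG3 : ∀ Y : Fin 10 → (P2 × P2 → ℂ), IsOrthonormalFrame Y → PassesTests Y → (1 / 2 : ℝ) ≤ heightF Y) :
    ∀ S : P2 → P2 → P2 → ℂ, tensorRank S ≤ 6 →
      ‖∑ a, ∑ b, ∑ c, S a b c * matMulTensor ℂ 2 2 2 a b c‖ ^ 2 ≤ 7 * ∑ a, ∑ b, ∑ c, ‖S a b c‖ ^ 2 := by
  intro S hS
  obtain ⟨Y, hY, hP, hann⟩ := hG1 S ((algBorderRank_le_tensorRank S).trans hS)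
  have h2 := hG2 S Y hY hann
  have h3 := hG3 Y hY hP
  have hpos : (0 : ℝ) ≤ ∑ a, ∑ b, ∑ c, ‖S a b c‖ ^ 2 := by positivity
  have hkey : 0 ≤ (2 * heightF Y - 1) * ∑ a, ∑ b, ∑ c, ‖S a b c‖ ^ 2 :=
    mul_nonneg (by linarith) hpos
  nlinarith [hkey, h2]

/-- **`SevenEighthsLaw` from the three stubs** (concludes the crux decl BY NAME). -/
theorem SevenEighthsLaw_of : SevenEighthsLaw := by
  intro S hS
  exact sevenEighths_of_stubs stub_passingFrame_of_borderRank_le_six stub_outputElimination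
    stub_sharpGrassmannApolarity S hS

/-! ## Consistency with the landed Negative lane (the stub constants are forced) -/

/-- **`½` cannot be raised** (modulo the transport stubs G1, G2): for every `η > 0` some passing orthonormal
frame has height `< ½ + η` — from the landed tightness theorem `sevenEighthsLaw_tight` (the Bini-plus-one family
of honest rank-`≤ 6` tensors with ratio `7 − 28/(7m² + 4) ↑ 7`). So G3 is stated at the only admissible constant. -/
theorem heightHalf_sharp (η : ℝ) (hη : 0 < η) :
    ¬ (∀ Y : Fin 10 → (P2 × P2 → ℂ), IsOrthonormalFrame Y → PassesTests Y → 1 / 2 + η ≤ heightF Y) := by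
  intro H
  obtain ⟨S, hS, hlt⟩ := sevenEighthsLaw_tight (2 * η) (by positivity)
  obtain ⟨Y, hY, hP, hann⟩ :=
    stub_passingFrame_of_borderRank_le_six S ((algBorderRank_le_tensorRank S).trans hS)
  have h2 := stub_outputElimination S Y hY hann
  have h3 := H Y hY hP
  have hpos : (0 : ℝ) ≤ ∑ a, ∑ b, ∑ c, ‖S a b c‖ ^ 2 := by positivity
  have hkey : 0 ≤ (2 * heightF Y - 1 - 2 * η) * ∑ a, ∑ b, ∑ c, ‖S a b c‖ ^ 2 :=
    mul_nonneg (by linarith) hpos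
  nlinarith [hkey, h2, hlt]

/-- **The value `½` is attained** (modulo G1, G2): the honest maximiser `⟨2,2,2⟩ − a₂₂⊗b₂₂⊗c₂₂` of the crux
(`sevenEighthsLaw_attained`: rank `≤ 6`, `‖S‖² = 7`, `|⟨S,T⟩|² = 49`) carries a passing orthonormal frame of
height `≤ ½`; with G3 its height is exactly `½` (numerically: the Winograd frame `Y₀`, `h(Y₀) = ½`, ranks
`(34,34)`), so the equality locus of G3 is non-empty and contains the frames of the whole orbit `⟨2,2,2⟩ − E_xyz`. -/
theorem exists_passingFrame_height_le_half :
    ∃ Y : Fin 10 → (P2 × P2 → ℂ), IsOrthonormalFrame Y ∧ PassesTests Y ∧ heightF Y ≤ 1 / 2 := by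
  obtain ⟨S, hS, hN, hEq⟩ := sevenEighthsLaw_attained
  obtain ⟨Y, hY, hP, hann⟩ :=
    stub_passingFrame_of_borderRank_le_six S ((algBorderRank_le_tensorRank S).trans hS)
  refine ⟨Y, hY, hP, ?_⟩
  have h2 := stub_outputElimination S Y hY hann
  rw [hEq, hN] at h2
  linarith

end Summit.MatrixMultiplication.MatrixMultiplication.Cruxes.SevenEighthsLaw.SharpGrassmannApolarity

end
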